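import Summits.AtomisticToContinuum.BoseEinsteinCondensation.Theses.BECPopovBerryRG

/-!
# `Lines/birth.lean` — birth-certificate skeleton (BC3) for crux `BerryStiffPhaseOS`
(stmt-AtomisticToContinuum-13936, rank-2 ENGINE of route `BECPopovBerryRG`, sub `BoseEinsteinCondensation`)

Registrar `planner-skel-stmt-AtomisticToContinuum-13936-0`, 2026-08-17 (mode skeleton-register; no new
routes, no proving beyond the assembly).  The crux is FIXED: its decl and signature are the route's
(`Summit.AtomisticToContinuum.BoseEinsteinCondensation.Theses.BECPopovBerryRG.BerryStiffPhaseOS`, rev 4,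
the OS-real class engine).  This file cuts it into THREE named stubs along the seams the route header
itself names (TWO-LAYER PLAN "new input: |Z| > 0 from convergence"; REPAIR HISTORY (iii) "so Z and the
insertion integrals are real numbers"; the Fröhlich–Spencer / Gawedzki–Kupiainen equal-time bound), and
proves the composition (`of_parts`, pure logic + constant merging + one line of complex arithmetic, no
`sorry`; `BerryStiffPhaseOS_of : BerryStiffPhaseOS := of_parts stub_osReality stub_nonvanishing stub_coherenceRe`).

## Stubs (sorries live ONLY here)

* `stub_osReality : ∀ m n, Reality m n` — OS / REFLECTION REALITY (hypothesis (iii) of rev 4 made a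
  lemma): for EVERY torus and every datum whose spatial bonds are real, temporal bond Hermitian
  (`B (−η) = conj B η`), remainders `w` and large-field activities `g` reflection-conjugate, the
  partition function `Z = ∫ wt` is REAL, and so is every equal-time insertion integral
  `∫ cos(θ_x − θ_y)·O·P·wt` with reflection-conjugate `O`, `P` through the common slice `t₀ = x.2`.
  No smallness, periodicity or measurability is needed: the time reflection `R_t` permutes the
  coordinates of the cube `[0,2π)^sites` (measure-preserving), maps the bond set to itself (spatial
  bonds at the reflected slice; temporal bonds reversed, `B₃(−η) = conj B₃(η)`), `F ↦ R_t F` is a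
  bijection of `Finset`s, and `wt (θ ∘ R_t) = conj (wt θ)` termwise.  [size M/L in Lean: `Finset.prod`
  re-indexing under the two involutions `s ↦ R_t s`, `s ↦ R_t s − e_τ`, `Finset.sum` over `F` re-indexed
  by `Finset.image`, `MeasurePreserving` coordinate permutation of the pi-cube, `integral_conj`;
  PROVABLE NOW — it is the statement CHOICE-g3.md ("Z is REAL for every member") and KREIN.md
  (J-self-adjointness) record informally.]
* `stub_nonvanishing : ∀ Λ ≥ 1, ∀ R, ∃ ε₀ K₀ > 0, ∀ ε ∈ (0, ε₀], ∀ K ≥ K₀, Nonvanishing Λ R ε K` —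
  NON-VANISHING OF THE COMPLEX PARTITION FUNCTION: under the full hypothesis list of the crux (stiffness
  window, Berry offset with `δ(m+2)³ ∈ ℤ`, Gaussian core + Peierls floor, `ε`-dominated complex range-`R`
  remainders, `e^{−K|F|}` large-field activities with (i) polymer factorisation, (ii) U(1) invariance,
  (iii) OS-reality) `Z ≠ 0`, uniformly in `m, n`.  This is the "new input |Z| > 0 from convergence" of
  the route's two-layer plan and the EXACT target of all three recorded class-boundary witness families
  (free set-function `g` ⇒ `Z = 0`, refuted 14490; `iε₀K e_x cos θ_x` ⇒ `J₀`-sign change; time-odd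
  complex `w` ⇒ θ₁-null, WITNESS3.md) — each excluded by a hypothesis this stub carries ((i), (ii), (iii)
  respectively).  Expected proof: Gawedzki–Kupiainen / Balaban–O'Carroll multiscale cluster expansion
  about the massless Gaussian of stiffness `Kd`, complex polymer activities, Kotecký–Preiss convergence
  (`Literature.Probability.LatticeModels.koteckyPreiss_truncatedWeight_bound` is in tree), winding
  sectors summed as θ₃'s with REAL argument (OS-reality).  [size XL / open-problem — the HARDEST stub.]
* `stub_coherenceRe : ∀ Λ ≥ 1, ∀ R, ∃ ε₀ K₀ C > 0, ∀ ε ∈ (0, ε₀], ∀ K ≥ K₀, CoherenceRe Λ R ε K C` —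
  FRÖHLICH–SPENCER × GK EQUAL-TIME COHERENCE, REAL PART: under the same hypotheses and GIVEN `Z ≠ 0`,
  for equal-time `x, y` and admissible insertions `O, P`,
  `|Re ∫ cos(θ_x − θ_y)·O·P·wt − Re Z| ≤ (C/√K)·‖Z‖`.  Only the real part is asked: by `stub_osReality`
  the class is secretly a SIGNED REAL weight `Re wt`, so the spin-wave + vortex-sheet energy–entropy
  analysis runs on a real (non-positive) measure — the "θ₃ with real argument" remark of the route
  header; the complex-norm statement of the crux is recovered in the assembly.  [size XL.]

## Assembly

`of_parts : (∀ m n, Reality m n) → <stub_nonvanishing sig> → <stub_coherenceRe sig> → <crux, verbatim>`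
(no `sorry`; axioms `propext`, `Classical.choice`, `Quot.sound`): given `Λ, R`, take `ε₀ := min ε₁ ε₂`,
`K₀ := max K₁ K₂`, `C := C₂`; feed the crux's data to `Nonvanishing` (at `ε₀ ≤ ε₁`, `K ≥ K₁`) for
`Z ≠ 0`, to `CoherenceRe` (at `ε₀ ≤ ε₂`, `K ≥ K₂`) for the real-part bound, and to `Reality` for
`Im Z = 0`, `Im ∫… = 0`; then `‖∫… − Z‖ = |Re ∫… − Re Z|`.  The skeleton theorem
`BerryStiffPhaseOS_of : BerryStiffPhaseOS := of_parts stub_osReality stub_nonvanishing stub_coherenceRe`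
concludes the route decl BY NAME with no hypotheses (tree convention for `#h21_check_skeleton`, cf.
`Summits/ABC/ABC/Cruxes/ManyPrimeValuationProduct/Lines/unramified_window_census.lean`).  Every stub is
load-bearing (drop `stub_osReality` and the real-part bound no longer gives the norm bound; drop either of
the other two and one conjunct of the crux is missing).

## BC3 probes (planner folder `bc/`, quoted in NOTES.md): for each stub `S`,
`example (h : S) : BerryStiffPhaseOS` and `example (h : S) : _root_.BoseEinsteinCondensation` by
`first | exact? | simpa | simpa using h | aesop` FAIL (6/6); control `BerryStiffPhaseOS → BerryStiffPhaseOS`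
succeeds.  No stub is the crux or the summit in costume: `Reality` has no smallness and no conclusion
about `Z ≠ 0`; `Nonvanishing` says nothing about correlations; `CoherenceRe` is conditional on `Z ≠ 0`
and bounds real parts only.

The `def`s below are VERBATIM slices of the route decl's signature (same binder names, same `let`s,
same `open`s as the route file), so the crux's hypotheses feed them by definitional unfolding.
-/

namespace Summit.AtomisticToContinuum.BoseEinsteinCondensation.Cruxes.BerryStiffPhaseOS.Birth

open scoped BigOperators Topology Manifold Classical MeasureTheory ProbabilityTheory Matrix InnerProductSpace ComplexConjugate ContinuousMap
open Filter Set Function TopologicalSpace MeasureTheory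
open Summit.AtomisticToContinuum.BoseEinsteinCondensation.Theses.BECPopovBerryRG (BerryStiffPhaseOS)

/-- OS / reflection reality package (hypothesis (iii) of the rev-4 class, nothing else): on the torus
`(ℤ/(m+2))³ × ℤ/(n+2)`, for bond factors with real spatial part and Hermitian temporal part, and
reflection-conjugate `w`, `g`, the weight `wt` of the crux has real total mass `Z`, and every equal-time
insertion integral with reflection-conjugate `O`, `P` is real.  (Verbatim sub-signature of the crux.) -/
def Reality (m n : ℕ) : Prop :=
  ∀ B : Fin 4 → ℝ → ℂ, (∀ i : Fin 3, ∀ η, B (Fin.castSucc i) (-η) = B (Fin.castSucc i) η ∧ (B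
    (Fin.castSucc i) η).im = 0) → (∀ η, B (Fin.last 3) (-η) = (starRingEnd ℂ) (B (Fin.last 3) η)) →
    let refl : Fin (n + 2) → ((Fin 3 → Fin (m + 2)) × Fin (n + 2)) → ((Fin 3 → Fin (m + 2)) × Fin (n
        + 2)) := fun t s => (s.1, t + (t - s.2));
    ∀ w : ((Fin 3 → Fin (m + 2)) × Fin (n + 2)) → (((Fin 3 → Fin (m + 2)) × Fin (n + 2)) → ℝ) → ℂ,
    (∀ t x θ, w (refl t x) (fun s => θ (refl t s)) = (starRingEnd ℂ) (w x θ)) → ∀ g : Finset ((Fin 3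
    → Fin (m + 2)) × Fin (n + 2)) → (((Fin 3 → Fin (m + 2)) × Fin (n + 2)) → ℝ) → ℂ, (∀ t F θ, g
    (F.image (refl t)) (fun s => θ (refl t s)) = (starRingEnd ℂ) (g F θ)) →
    let wt : (((Fin 3 → Fin (m + 2)) × Fin (n + 2)) → ℝ) → ℂ := fun θ => ∑ F : Finset ((Fin 3 → Fin
        (m + 2)) × Fin (n + 2)), g F θ * (∏ s : ((Fin 3 → Fin (m + 2)) × Fin (n + 2)), (∏ i : Fin 3,
        if s ∉ F ∧ (s.1 + Pi.single i 1, s.2) ∉ F then B (Fin.castSucc i) (θ (s.1 + Pi.single i 1,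
        s.2) - θ s) else 1) * (if s ∉ F ∧ (s.1, s.2 + 1) ∉ F then B (Fin.last 3) (θ (s.1, s.2 + 1) -
        θ s) else 1)) * Complex.exp (-∑ x ∈ Fᶜ, w x θ);
    let Z : ℂ := ∫ θ in Set.pi Set.univ (fun _ : ((Fin 3 → Fin (m + 2)) × Fin (n + 2)) => Set.Ico (0
        : ℝ) (2 * Real.pi)), wt θ;
    Z.im = 0 ∧ ∀ x y : ((Fin 3 → Fin (m + 2)) × Fin (n + 2)), x.2 = y.2 → ∀ O P : (((Fin 3 → Fin (m
    + 2)) × Fin (n + 2)) → ℝ) → ℂ, (∀ θ, O (fun s => θ (refl x.2 s)) = (starRingEnd ℂ) (O θ)) → (∀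
    θ, P (fun s => θ (refl x.2 s)) = (starRingEnd ℂ) (P θ)) → (∫ θ in Set.pi Set.univ (fun _ : ((Fin
    3 → Fin (m + 2)) × Fin (n + 2)) => Set.Ico (0 : ℝ) (2 * Real.pi)), (Real.cos (θ x - θ y) : ℂ) *
    O θ * P θ * wt θ).im = 0

/-- The crux body with conclusion `Z ≠ 0` only (all hypotheses verbatim; parameters `Λ R ε₀ K` free as in
the route decl after its `∃ ε₀ K₀ C` / `∀ K ≥ K₀` prefix). -/
def Nonvanishing (Λ : ℝ) (R : ℕ) (ε₀ K : ℝ) : Prop :=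
  ∀ m n : ℕ, ∀ Kd : Fin 4 → ℝ, (∀ i, K ≤ Kd i ∧ Kd i ≤ Λ * K) → ∀ δ : ℝ, |δ| ≤ 1 / 2 → (∃ z : ℤ, δ *
    ((m + 2 : ℕ) : ℝ) ^ 3 = (z : ℝ)) → ∀ B : Fin 4 → ℝ → ℂ, (∀ i, Measurable (B i)) → (∀ i η, B i (η
    + 2 * Real.pi) = B i η) → (∀ i : Fin 3, ∀ η, B (Fin.castSucc i) (-η) = B (Fin.castSucc i) η ∧ (B
    (Fin.castSucc i) η).im = 0) → (∀ η, B (Fin.last 3) (-η) = (starRingEnd ℂ) (B (Fin.last 3) η)) →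
    (∀ i η, |η| ≤ 1 / (4 * Λ) → ∃ u : ℂ, ‖u‖ ≤ K * η ^ 2 * (ε₀ * |η| + Λ * η ^ 2) ∧ B i η =
    Complex.exp (((-(Kd i * η ^ 2 / 2) : ℝ) : ℂ) + ((if i = Fin.last 3 then δ * η else 0 : ℝ) : ℂ) *
    Complex.I + u)) → (∀ i η, |η| ≤ Real.pi → ‖B i η‖ ≤ 2 * Real.exp (-(K * (1 - Real.cos η) / 2)))
    →
    let near : ((Fin 3 → Fin (m + 2)) × Fin (n + 2)) → ((Fin 3 → Fin (m + 2)) × Fin (n + 2)) → Prop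
        := fun x y => (∀ i, ((y.1 i - x.1 i : Fin (m + 2)) : ℕ) ≤ R ∨ ((x.1 i - y.1 i : Fin (m + 2))
        : ℕ) ≤ R) ∧ (((y.2 - x.2 : Fin (n + 2)) : ℕ) ≤ R ∨ ((x.2 - y.2 : Fin (n + 2)) : ℕ) ≤ R);
    let e : ((Fin 3 → Fin (m + 2)) × Fin (n + 2)) → (((Fin 3 → Fin (m + 2)) × Fin (n + 2)) → ℝ) → ℝ
        := fun s θ => (∑ i : Fin 3, (1 - Real.cos (θ (s.1 + Pi.single i 1, s.2) - θ s))) + (1 -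
        Real.cos (θ (s.1, s.2 + 1) - θ s));
    let refl : Fin (n + 2) → ((Fin 3 → Fin (m + 2)) × Fin (n + 2)) → ((Fin 3 → Fin (m + 2)) × Fin (n
        + 2)) := fun t s => (s.1, t + (t - s.2));
    ∀ w : ((Fin 3 → Fin (m + 2)) × Fin (n + 2)) → (((Fin 3 → Fin (m + 2)) × Fin (n + 2)) → ℝ) → ℂ,
    (∀ x, Measurable (w x)) → (∀ x θ y, w x (θ + Pi.single y (2 * Real.pi)) = w x θ) → (∀ x θ θ', (∀
    y, near x y → θ y = θ' y) → w x θ = w x θ') → (∀ x θ, ‖w x θ‖ ≤ ε₀ * K * ∑ y, if near x y then e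
    y θ else 0) → (∀ x θ (a : ℝ), w x (fun s => θ s + a) = w x θ) → (∀ t x θ, w (refl t x) (fun s =>
    θ (refl t s)) = (starRingEnd ℂ) (w x θ)) → ∀ g : Finset ((Fin 3 → Fin (m + 2)) × Fin (n + 2)) →
    (((Fin 3 → Fin (m + 2)) × Fin (n + 2)) → ℝ) → ℂ, (∀ F, Measurable (g F)) → (∀ θ, g ∅ θ = 1) → (∀
    F θ θ', (∀ y, (∃ x ∈ F, near x y) → θ y = θ' y) → g F θ = g F θ') → (∀ F θ, ‖g F θ‖ ≤ Real.exp
    (-(K * F.card))) → (∀ F θ (a : ℝ), g F (fun s => θ s + a) = g F θ) → (∀ F₁ F₂ θ, (∀ x ∈ F₁, ∀ y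
    ∈ F₂, ¬ near x y) → g (F₁ ∪ F₂) θ = g F₁ θ * g F₂ θ) → (∀ t F θ, g (F.image (refl t)) (fun s =>
    θ (refl t s)) = (starRingEnd ℂ) (g F θ)) →
    let wt : (((Fin 3 → Fin (m + 2)) × Fin (n + 2)) → ℝ) → ℂ := fun θ => ∑ F : Finset ((Fin 3 → Fin
        (m + 2)) × Fin (n + 2)), g F θ * (∏ s : ((Fin 3 → Fin (m + 2)) × Fin (n + 2)), (∏ i : Fin 3,
        if s ∉ F ∧ (s.1 + Pi.single i 1, s.2) ∉ F then B (Fin.castSucc i) (θ (s.1 + Pi.single i 1,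
        s.2) - θ s) else 1) * (if s ∉ F ∧ (s.1, s.2 + 1) ∉ F then B (Fin.last 3) (θ (s.1, s.2 + 1) -
        θ s) else 1)) * Complex.exp (-∑ x ∈ Fᶜ, w x θ);
    let Z : ℂ := ∫ θ in Set.pi Set.univ (fun _ : ((Fin 3 → Fin (m + 2)) × Fin (n + 2)) => Set.Ico (0
        : ℝ) (2 * Real.pi)), wt θ;
    Z ≠ 0

/-- The crux body with conclusion: `Z ≠ 0 →` the equal-time coherence bound for REAL PARTS,
`|Re ∫ cos(θ_x − θ_y)·O·P·wt − Re Z| ≤ (C/√K)·‖Z‖` (all hypotheses verbatim). -/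
def CoherenceRe (Λ : ℝ) (R : ℕ) (ε₀ K C : ℝ) : Prop :=
  ∀ m n : ℕ, ∀ Kd : Fin 4 → ℝ, (∀ i, K ≤ Kd i ∧ Kd i ≤ Λ * K) → ∀ δ : ℝ, |δ| ≤ 1 / 2 → (∃ z : ℤ, δ *
    ((m + 2 : ℕ) : ℝ) ^ 3 = (z : ℝ)) → ∀ B : Fin 4 → ℝ → ℂ, (∀ i, Measurable (B i)) → (∀ i η, B i (η
    + 2 * Real.pi) = B i η) → (∀ i : Fin 3, ∀ η, B (Fin.castSucc i) (-η) = B (Fin.castSucc i) η ∧ (B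
    (Fin.castSucc i) η).im = 0) → (∀ η, B (Fin.last 3) (-η) = (starRingEnd ℂ) (B (Fin.last 3) η)) →
    (∀ i η, |η| ≤ 1 / (4 * Λ) → ∃ u : ℂ, ‖u‖ ≤ K * η ^ 2 * (ε₀ * |η| + Λ * η ^ 2) ∧ B i η =
    Complex.exp (((-(Kd i * η ^ 2 / 2) : ℝ) : ℂ) + ((if i = Fin.last 3 then δ * η else 0 : ℝ) : ℂ) *
    Complex.I + u)) → (∀ i η, |η| ≤ Real.pi → ‖B i η‖ ≤ 2 * Real.exp (-(K * (1 - Real.cos η) / 2)))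
    →
    let near : ((Fin 3 → Fin (m + 2)) × Fin (n + 2)) → ((Fin 3 → Fin (m + 2)) × Fin (n + 2)) → Prop
        := fun x y => (∀ i, ((y.1 i - x.1 i : Fin (m + 2)) : ℕ) ≤ R ∨ ((x.1 i - y.1 i : Fin (m + 2))
        : ℕ) ≤ R) ∧ (((y.2 - x.2 : Fin (n + 2)) : ℕ) ≤ R ∨ ((x.2 - y.2 : Fin (n + 2)) : ℕ) ≤ R);
    let e : ((Fin 3 → Fin (m + 2)) × Fin (n + 2)) → (((Fin 3 → Fin (m + 2)) × Fin (n + 2)) → ℝ) → ℝ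
        := fun s θ => (∑ i : Fin 3, (1 - Real.cos (θ (s.1 + Pi.single i 1, s.2) - θ s))) + (1 -
        Real.cos (θ (s.1, s.2 + 1) - θ s));
    let refl : Fin (n + 2) → ((Fin 3 → Fin (m + 2)) × Fin (n + 2)) → ((Fin 3 → Fin (m + 2)) × Fin (n
        + 2)) := fun t s => (s.1, t + (t - s.2));
    ∀ w : ((Fin 3 → Fin (m + 2)) × Fin (n + 2)) → (((Fin 3 → Fin (m + 2)) × Fin (n + 2)) → ℝ) → ℂ,
    (∀ x, Measurable (w x)) → (∀ x θ y, w x (θ + Pi.single y (2 * Real.pi)) = w x θ) → (∀ x θ θ', (∀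
    y, near x y → θ y = θ' y) → w x θ = w x θ') → (∀ x θ, ‖w x θ‖ ≤ ε₀ * K * ∑ y, if near x y then e
    y θ else 0) → (∀ x θ (a : ℝ), w x (fun s => θ s + a) = w x θ) → (∀ t x θ, w (refl t x) (fun s =>
    θ (refl t s)) = (starRingEnd ℂ) (w x θ)) → ∀ g : Finset ((Fin 3 → Fin (m + 2)) × Fin (n + 2)) →
    (((Fin 3 → Fin (m + 2)) × Fin (n + 2)) → ℝ) → ℂ, (∀ F, Measurable (g F)) → (∀ θ, g ∅ θ = 1) → (∀
    F θ θ', (∀ y, (∃ x ∈ F, near x y) → θ y = θ' y) → g F θ = g F θ') → (∀ F θ, ‖g F θ‖ ≤ Real.exp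
    (-(K * F.card))) → (∀ F θ (a : ℝ), g F (fun s => θ s + a) = g F θ) → (∀ F₁ F₂ θ, (∀ x ∈ F₁, ∀ y
    ∈ F₂, ¬ near x y) → g (F₁ ∪ F₂) θ = g F₁ θ * g F₂ θ) → (∀ t F θ, g (F.image (refl t)) (fun s =>
    θ (refl t s)) = (starRingEnd ℂ) (g F θ)) →
    let wt : (((Fin 3 → Fin (m + 2)) × Fin (n + 2)) → ℝ) → ℂ := fun θ => ∑ F : Finset ((Fin 3 → Fin
        (m + 2)) × Fin (n + 2)), g F θ * (∏ s : ((Fin 3 → Fin (m + 2)) × Fin (n + 2)), (∏ i : Fin 3,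
        if s ∉ F ∧ (s.1 + Pi.single i 1, s.2) ∉ F then B (Fin.castSucc i) (θ (s.1 + Pi.single i 1,
        s.2) - θ s) else 1) * (if s ∉ F ∧ (s.1, s.2 + 1) ∉ F then B (Fin.last 3) (θ (s.1, s.2 + 1) -
        θ s) else 1)) * Complex.exp (-∑ x ∈ Fᶜ, w x θ);
    let Z : ℂ := ∫ θ in Set.pi Set.univ (fun _ : ((Fin 3 → Fin (m + 2)) × Fin (n + 2)) => Set.Ico (0
        : ℝ) (2 * Real.pi)), wt θ;
    Z ≠ 0 → ∀ x y : ((Fin 3 → Fin (m + 2)) × Fin (n + 2)), x.2 = y.2 → ∀ O P : (((Fin 3 → Fin (m +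
    2)) × Fin (n + 2)) → ℝ) → ℂ, Measurable O → Measurable P → (∀ θ θ', (∀ s, near x s → θ s = θ' s)
    → O θ = O θ') → (∀ θ θ', (∀ s, near y s → θ s = θ' s) → P θ = P θ') → (∀ θ, ‖O θ - 1‖ ≤ ∑ s, if
    near x s then Real.sqrt (e s θ) else 0) → (∀ θ, ‖P θ - 1‖ ≤ ∑ s, if near y s then Real.sqrt (e s
    θ) else 0) → (∀ θ (a : ℝ), O (fun s => θ s + a) = O θ) → (∀ θ (a : ℝ), P (fun s => θ s + a) = P
    θ) → (∀ θ, O (fun s => θ (refl x.2 s)) = (starRingEnd ℂ) (O θ)) → (∀ θ, P (fun s => θ (refl x.2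
    s)) = (starRingEnd ℂ) (P θ)) → |(∫ θ in Set.pi Set.univ (fun _ : ((Fin 3 → Fin (m + 2)) × Fin (n
    + 2)) => Set.Ico (0 : ℝ) (2 * Real.pi)), (Real.cos (θ x - θ y) : ℂ) * O θ * P θ * wt θ).re -
    Z.re| ≤ C / Real.sqrt K * ‖Z‖

/-- stub 1 — OS-REALITY (hypothesis (iii) at work; provable now, size M/L): `Z` and the equal-time
insertion integrals are real for every reflection-real datum, on every torus, with no smallness. -/
theorem stub_osReality : ∀ m n : ℕ, Reality m n := by
  sorry

/-- stub 2 — NON-VANISHING of the complex partition function of the OS-real small-field/large-field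
class (the witness battleground; GK/Balaban–O'Carroll multiscale expansion + Kotecký–Preiss; size XL,
the hardest stub).  Uniform in `ε ∈ (0, ε₀]` so that constants merge in the assembly. -/
theorem stub_nonvanishing :
  ∀ Λ : ℝ, 1 ≤ Λ → ∀ R : ℕ, ∃ ε₀ K₀ : ℝ, 0 < ε₀ ∧ 0 < K₀ ∧ ∀ ε : ℝ, 0 < ε → ε ≤ ε₀ → ∀ K : ℝ, K₀ ≤ K
    → Nonvanishing Λ R ε K := by
  sorry

/-- stub 3 — FRÖHLICH–SPENCER × GK EQUAL-TIME COHERENCE for real parts, conditional on `Z ≠ 0`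
(spin waves + vortex-sheet energy–entropy bounds on the signed real weight `Re wt`; size XL). -/
theorem stub_coherenceRe :
  ∀ Λ : ℝ, 1 ≤ Λ → ∀ R : ℕ, ∃ ε₀ K₀ C : ℝ, 0 < ε₀ ∧ 0 < K₀ ∧ 0 < C ∧ ∀ ε : ℝ, 0 < ε → ε ≤ ε₀ → ∀ K :
    ℝ, K₀ ≤ K → CoherenceRe Λ R ε K C := by
  sorry

/-- Elementary: a complex number with vanishing imaginary part has norm `|re|`. -/
theorem norm_sub_eq_abs_re_sub_re (I Z : ℂ) (hI : I.im = 0) (hZ : Z.im = 0) :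
    ‖I - Z‖ = |I.re - Z.re| := by
  have h : I - Z = ((I.re - Z.re : ℝ) : ℂ) := Complex.ext (by simp) (by simp [hI, hZ])
  rw [h, Complex.norm_real, Real.norm_eq_abs]

/-- THE DECOMPOSITION, closed form (kernel-checked, no `sorry`): the three stub statements imply the
crux — stated here with the crux written out VERBATIM (the route decl's signature, character for character),
so that only `BerryStiffPhaseOS_of` below concludes the route decl BY NAME (skeleton audit (i)/(ii)); the
`example` after it certifies that this verbatim statement IS the route decl (definitional unfolding only). -/
theorem of_parts :
    (∀ m n : ℕ, Reality m n) →
    (∀ Λ : ℝ, 1 ≤ Λ → ∀ R : ℕ, ∃ ε₀ K₀ : ℝ, 0 < ε₀ ∧ 0 < K₀ ∧ ∀ ε : ℝ, 0 < ε → ε ≤ ε₀ → ∀ K : ℝ, K₀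
      ≤ K → Nonvanishing Λ R ε K) →
    (∀ Λ : ℝ, 1 ≤ Λ → ∀ R : ℕ, ∃ ε₀ K₀ C : ℝ, 0 < ε₀ ∧ 0 < K₀ ∧ 0 < C ∧ ∀ ε : ℝ, 0 < ε → ε ≤ ε₀ → ∀
      K : ℝ, K₀ ≤ K → CoherenceRe Λ R ε K C) →
    ∀ Λ : ℝ, 1 ≤ Λ → ∀ R : ℕ, ∃ ε₀ K₀ C : ℝ, 0 < ε₀ ∧ 0 < K₀ ∧ 0 < C ∧ ∀ K : ℝ, K₀ ≤ K → ∀ m n : ℕ,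
      ∀ Kd : Fin 4 → ℝ, (∀ i, K ≤ Kd i ∧ Kd i ≤ Λ * K) → ∀ δ : ℝ, |δ| ≤ 1 / 2 → (∃ z : ℤ, δ * ((m +
      2 : ℕ) : ℝ) ^ 3 = (z : ℝ)) → ∀ B : Fin 4 → ℝ → ℂ, (∀ i, Measurable (B i)) → (∀ i η, B i (η + 2
      * Real.pi) = B i η) → (∀ i : Fin 3, ∀ η, B (Fin.castSucc i) (-η) = B (Fin.castSucc i) η ∧ (B
      (Fin.castSucc i) η).im = 0) → (∀ η, B (Fin.last 3) (-η) = (starRingEnd ℂ) (B (Fin.last 3) η))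
      → (∀ i η, |η| ≤ 1 / (4 * Λ) → ∃ u : ℂ, ‖u‖ ≤ K * η ^ 2 * (ε₀ * |η| + Λ * η ^ 2) ∧ B i η =
      Complex.exp (((-(Kd i * η ^ 2 / 2) : ℝ) : ℂ) + ((if i = Fin.last 3 then δ * η else 0 : ℝ) : ℂ)
      * Complex.I + u)) → (∀ i η, |η| ≤ Real.pi → ‖B i η‖ ≤ 2 * Real.exp (-(K * (1 - Real.cos η) /
      2))) →
      let near : ((Fin 3 → Fin (m + 2)) × Fin (n + 2)) → ((Fin 3 → Fin (m + 2)) × Fin (n + 2)) →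
          Prop := fun x y => (∀ i, ((y.1 i - x.1 i : Fin (m + 2)) : ℕ) ≤ R ∨ ((x.1 i - y.1 i : Fin
          (m + 2)) : ℕ) ≤ R) ∧ (((y.2 - x.2 : Fin (n + 2)) : ℕ) ≤ R ∨ ((x.2 - y.2 : Fin (n + 2)) :
          ℕ) ≤ R);
      let e : ((Fin 3 → Fin (m + 2)) × Fin (n + 2)) → (((Fin 3 → Fin (m + 2)) × Fin (n + 2)) → ℝ) →
          ℝ := fun s θ => (∑ i : Fin 3, (1 - Real.cos (θ (s.1 + Pi.single i 1, s.2) - θ s))) + (1 -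
          Real.cos (θ (s.1, s.2 + 1) - θ s));
      let refl : Fin (n + 2) → ((Fin 3 → Fin (m + 2)) × Fin (n + 2)) → ((Fin 3 → Fin (m + 2)) × Fin
          (n + 2)) := fun t s => (s.1, t + (t - s.2));
      ∀ w : ((Fin 3 → Fin (m + 2)) × Fin (n + 2)) → (((Fin 3 → Fin (m + 2)) × Fin (n + 2)) → ℝ) → ℂ,
      (∀ x, Measurable (w x)) → (∀ x θ y, w x (θ + Pi.single y (2 * Real.pi)) = w x θ) → (∀ x θ θ',
      (∀ y, near x y → θ y = θ' y) → w x θ = w x θ') → (∀ x θ, ‖w x θ‖ ≤ ε₀ * K * ∑ y, if near x y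
      then e y θ else 0) → (∀ x θ (a : ℝ), w x (fun s => θ s + a) = w x θ) → (∀ t x θ, w (refl t x)
      (fun s => θ (refl t s)) = (starRingEnd ℂ) (w x θ)) → ∀ g : Finset ((Fin 3 → Fin (m + 2)) × Fin
      (n + 2)) → (((Fin 3 → Fin (m + 2)) × Fin (n + 2)) → ℝ) → ℂ, (∀ F, Measurable (g F)) → (∀ θ, g
      ∅ θ = 1) → (∀ F θ θ', (∀ y, (∃ x ∈ F, near x y) → θ y = θ' y) → g F θ = g F θ') → (∀ F θ, ‖g F
      θ‖ ≤ Real.exp (-(K * F.card))) → (∀ F θ (a : ℝ), g F (fun s => θ s + a) = g F θ) → (∀ F₁ F₂ θ,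
      (∀ x ∈ F₁, ∀ y ∈ F₂, ¬ near x y) → g (F₁ ∪ F₂) θ = g F₁ θ * g F₂ θ) → (∀ t F θ, g (F.image
      (refl t)) (fun s => θ (refl t s)) = (starRingEnd ℂ) (g F θ)) →
      let wt : (((Fin 3 → Fin (m + 2)) × Fin (n + 2)) → ℝ) → ℂ := fun θ => ∑ F : Finset ((Fin 3 →
          Fin (m + 2)) × Fin (n + 2)), g F θ * (∏ s : ((Fin 3 → Fin (m + 2)) × Fin (n + 2)), (∏ i :
          Fin 3, if s ∉ F ∧ (s.1 + Pi.single i 1, s.2) ∉ F then B (Fin.castSucc i) (θ (s.1 +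
          Pi.single i 1, s.2) - θ s) else 1) * (if s ∉ F ∧ (s.1, s.2 + 1) ∉ F then B (Fin.last 3) (θ
          (s.1, s.2 + 1) - θ s) else 1)) * Complex.exp (-∑ x ∈ Fᶜ, w x θ);
      let Z : ℂ := ∫ θ in Set.pi Set.univ (fun _ : ((Fin 3 → Fin (m + 2)) × Fin (n + 2)) => Set.Ico
          (0 : ℝ) (2 * Real.pi)), wt θ;
      Z ≠ 0 ∧ ∀ x y : ((Fin 3 → Fin (m + 2)) × Fin (n + 2)), x.2 = y.2 → ∀ O P : (((Fin 3 → Fin (m +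
      2)) × Fin (n + 2)) → ℝ) → ℂ, Measurable O → Measurable P → (∀ θ θ', (∀ s, near x s → θ s = θ'
      s) → O θ = O θ') → (∀ θ θ', (∀ s, near y s → θ s = θ' s) → P θ = P θ') → (∀ θ, ‖O θ - 1‖ ≤ ∑
      s, if near x s then Real.sqrt (e s θ) else 0) → (∀ θ, ‖P θ - 1‖ ≤ ∑ s, if near y s then
      Real.sqrt (e s θ) else 0) → (∀ θ (a : ℝ), O (fun s => θ s + a) = O θ) → (∀ θ (a : ℝ), P (fun s
      => θ s + a) = P θ) → (∀ θ, O (fun s => θ (refl x.2 s)) = (starRingEnd ℂ) (O θ)) → (∀ θ, P (fun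
      s => θ (refl x.2 s)) = (starRingEnd ℂ) (P θ)) → ‖(∫ θ in Set.pi Set.univ (fun _ : ((Fin 3 →
      Fin (m + 2)) × Fin (n + 2)) => Set.Ico (0 : ℝ) (2 * Real.pi)), (Real.cos (θ x - θ y) : ℂ) * O
      θ * P θ * wt θ) - Z‖ ≤ C / Real.sqrt K * ‖Z‖ := by
  intro hR hZ hC Λ hΛ R
  obtain ⟨ε₁, K₁, hε₁, hK₁, h₁⟩ := hZ Λ hΛ R
  obtain ⟨ε₂, K₂, C, hε₂, hK₂, hCpos, h₂⟩ := hC Λ hΛ R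
  refine ⟨min ε₁ ε₂, max K₁ K₂, C, lt_min hε₁ hε₂, lt_max_iff.2 (Or.inl hK₁), hCpos, ?_⟩
  intro K hK m n Kd hKd δ hδ hδZ B hBm hBp hBs hBt hBc hBf near e refl w hwm hwp hwl hwb hwu hwr g hgm hg0 hgl
    hgb hgu hgf hgr wt Z
  have hK₁' : K₁ ≤ K := le_trans (le_max_left _ _) hK
  have hK₂' : K₂ ≤ K := le_trans (le_max_right _ _) hK
  have hε : 0 < min ε₁ ε₂ := lt_min hε₁ hε₂
  have hz : Z ≠ 0 :=
    h₁ (min ε₁ ε₂) hε (min_le_left _ _) K hK₁' m n Kd hKd δ hδ hδZ B hBm hBp hBs hBt hBc hBf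
      w hwm hwp hwl hwb hwu hwr g hgm hg0 hgl hgb hgu hgf hgr
  refine ⟨hz, ?_⟩
  intro x y hxy O P hOm hPm hOl hPl hOb hPb hOu hPu hOr hPr
  have hre := h₂ (min ε₁ ε₂) hε (min_le_right _ _) K hK₂' m n Kd hKd δ hδ hδZ B hBm hBp hBs hBt hBc hBf
      w hwm hwp hwl hwb hwu hwr g hgm hg0 hgl hgb hgu hgf hgr hz x y hxy O P hOm hPm hOl hPl hOb hPb hOu hPu
      hOr hPr
  have hreal := hR m n B hBs hBt w hwr g hgr
  exact (norm_sub_eq_abs_re_sub_re _ _ (hreal.2 x y hxy O P hOr hPr) hreal.1).trans_le hre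

/-- SKELETON THEOREM: the crux BY NAME from the three registered stubs (all open; `sorryAx` enters only
through `stub_osReality`, `stub_nonvanishing`, `stub_coherenceRe`). -/
theorem BerryStiffPhaseOS_of : BerryStiffPhaseOS :=
  of_parts stub_osReality stub_nonvanishing stub_coherenceRe

/-- Certificate that `of_parts` concludes the route decl literally (the verbatim statement unifies with
`Summit.AtomisticToContinuum.BoseEinsteinCondensation.Theses.BECPopovBerryRG.BerryStiffPhaseOS` by `δ`). -/
example :
    (∀ m n : ℕ, Reality m n) →
    (∀ Λ : ℝ, 1 ≤ Λ → ∀ R : ℕ, ∃ ε₀ K₀ : ℝ, 0 < ε₀ ∧ 0 < K₀ ∧ ∀ ε : ℝ, 0 < ε → ε ≤ ε₀ → ∀ K : ℝ, K₀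
      ≤ K → Nonvanishing Λ R ε K) →
    (∀ Λ : ℝ, 1 ≤ Λ → ∀ R : ℕ, ∃ ε₀ K₀ C : ℝ, 0 < ε₀ ∧ 0 < K₀ ∧ 0 < C ∧ ∀ ε : ℝ, 0 < ε → ε ≤ ε₀ → ∀
      K : ℝ, K₀ ≤ K → CoherenceRe Λ R ε K C) →
    Summit.AtomisticToContinuum.BoseEinsteinCondensation.Theses.BECPopovBerryRG.BerryStiffPhaseOS :=
  of_parts

end Summit.AtomisticToContinuum.BoseEinsteinCondensation.Cruxes.BerryStiffPhaseOS.Birth
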